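import Mathlib

/-!
# Bałaban's lattice Yang–Mills ultraviolet-stability series (CMP 1983–89): the citation DAG and the shape of its end statement

CITATION HEADER (lean-in-tree rule 2026-08-18). This module reproduces NO mathematics of the series. It is the
kernel-checked BOOKKEEPING LAYER of the audit cell `pub-balaban` (unit `b2b-balaban-carver`) for T. Bałaban's papers
*Comm. Math. Phys.* **89** 571–597 (1983) [Balaban1983RegularityDecay] (cell number B4); **95** 17–40 (1984)
[Balaban1984PropagatorsI] (B5); **96** 223–250 (1984) [Balaban1984PropagatorsII] (B6); **98** 17–51 (1985)
[Balaban1985Averaging] (B7); **99** 75–102 (1985) [Balaban1985RegularSpaces] (B8); **99** 389–434 (1985)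
[Balaban1985BackgroundPropagators] (B9); **102** 255–275 (1985) [Balaban1985UV3] (B10); **102** 277–309 (1985)
[Balaban1985Variational] (B11); **109** 249–301 (1987) [Balaban1987RG1] (B12); **116** 1–22 (1988) [Balaban1988RG2Cluster]
(B13); **119** 243–285 (1988) [Balaban1988Convergent] (B14); **122** 175–202 (1989) [Balaban1989LargeFieldI] (B15);
**122** 355–392 (1989) [Balaban1989LargeFieldII] (B16): ONE `Prop` per paper, read as the implication "conclusions of the
papers it cites (the citation sentences are located, with journal pages, in the cell's SERIES.md) → its own main
theorem(s)", and the theorem `uv_stability_of_series` composing the thirteen nodes into the END STATEMENT (B) of the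
series in its PRINTED, CONDITIONAL form

  `UVStability4D ℓ := ℓ.smallCouplings → (ℓ.densitiesDescribed ∧ ℓ.uvBounds)`,

i.e. [Balaban1989LargeFieldII] Thm 1 p. 355 — "If the sequence of the effective coupling constants is contained in an
interval ]0, γ] with a sufficiently small positive γ, then the effective densities ρ_k have the form, and satisfy all
the conditions and bounds, described in Sect. 2 [III]." — together with the bounds (0.1) there. WHY CONDITIONAL:
[Balaban1987RG1] Thm 2 p. 259 (d = 4, G = SU(2): a bare coupling g₀(ε, g) exists with all g_k ∈ ]0, γ], g_K = g and the
two-sided running (0.31)), which would discharge the hypothesis, is printed without proof ("A proof of this theorem …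
will be given in a separate paper", p. 259), and [Balaban1989LargeFieldII] p. 355 records "has not been published yet,
so we have Theorem 1 with the assumption". All these statements are CLAIMS UNDER ADJUDICATION by the cell: here they
are abstract propositions, never asserted.

DESIGN (v4 = first tree version; v4.1 adds the located direct edges B7 → B16, B13 → B16; v4.2 re-sources node N12
with the two located edges B5 → B15, B11 → B15 — [Balaban1989LargeFieldI] prints its Prop. 1 p. 194 without proof and
the only printed proof, [Balaban1989LargeFieldII] pp. 358–359, rests on (1.65)–(1.67) of [10] = B5 and "Proposition 4
[15]" = B11 (cell GAPS G-pv14-1); v1–v3 lived in the cell package as `BalabanYm4.Dag` with `opaque` atoms). The leaves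
are the fields of the structure `Leaves`: abstract propositions standing for the quoted main-theorem blocks (each
field's docstring gives paper, statement numbers and journal pages; the verbatim texts, render-checked, are in the
cell's SERIES.md / FINAL-STATEMENT.md / STEP.md). They are PARAMETERS, not stubs: every theorem below holds for every
assignment `ℓ : Leaves`, and `hyp_loadBearing` exhibits, for each of the fourteen hypotheses of
`uv_stability_of_series`, an assignment (`dropWitness`) under which all other hypotheses hold and (B) fails — the
composition is not vacuous and no node is decorative. The per-paper modules of this directory type the printed
statements themselves over paper-specific carriers (landed so far: `B5.Prop11Printed`/`Prop12Printed`,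
`B6.Lemma21Printed` … `Cor28Printed`, `B7.Prop1Printed` … `Prop10Printed`, `B8.Thm2Printed` … `Thm8Printed`,
`B9.Thm31Printed` … `Thm315Printed`, `B10.Thm1Printed`/`Thm2Printed`, `B12.Thm1Printed`/`Thm2Printed`/`Thm3Printed`;
`B11`, `B13`–`B16` and `Step` are staged in the cell package and proposed by their owners); a later binding module
instantiates `Leaves` with them (planned: `smallCouplings ↦ Setup.Flow.InInterval`, `running ↦ Setup.Flow.LogRunning`,
`b12`-side and `densitiesDescribed`/`uvBounds` ↦ the conclusions of `B12.Thm3Printed` and of the staged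
`B16.Thm1Printed`/`B16.UVBound01`, `flowControl ↦` the staged `B14.FlowIneq26`–`28` with the (2.46) sum bound,
`betaPositive ↦ Step`'s `0 < b ≤ β_j`). Nothing here imports them, so that the DAG quantifies over ALL assignments
and does not wait for the remaining modules; only `Mathlib` is imported (tactics).

LOCATED UNPRINTED STEPS (the audit census in kernel form; ids of the cell's GAPS.md in brackets). Besides B12 Thm 2
[G1]: (T11.F) [Balaban1988Convergent] p. 255 uses, inside the inductive description of §2, the flow inequalities
(2.6)–(2.9) for the couplings, justified only by "The inequalities follow from the renormalization group equations
(0.20) [I], and from the properties of the β-functions."; the β-function properties printed in [I] ([Balaban1987RG1]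
p. 264: "It is a smooth function defined on the interval [0, γ], (or analytic), uniformly bounded on this interval
together with all derivatives. We will investigate other properties in a separate paper.") do not include the SIGN /
positive lower bound the derivation uses [G-r2.1]; and the middle inequality of (2.46), p. 263, needs (0.31)-type
running of the couplings, not the interval hypothesis [G-f2.1] (kernel-checked in the staged `Step`, Part A: over
arbitrary sequences in ]0, 1/2] the inequality fails for g_j ≡ 1/2, n = 65). Hence `FlowStepPrinted` (interval
hypothesis → flow control, exactly as B14 uses it) is an explicit hypothesis of `uv_stability_of_series`, and
`FlowStepOfBeta` / `Thm2OfBeta` display the single unprinted analytic input to which both located steps reduce: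
(T09.F) uniform positivity of the β-functions, `Leaves.betaPositive` [G-f2.2] (the elementary reductions are
kernel-checked on real sequences in the staged `Step`; here they are hypotheses). `uv_stability_modulo_beta` is the
resulting sharpest bookkeeping statement.

RELATION TO EXISTING TREE MATERIAL (not restated; reviewers please note). `Literature.MathematicalPhysics.QuantumLattice`
(`BalabanRG.lean`: `BlockRGScheme`, `HasUVStabilityBounds`) and `…QuantumFieldTheory.ConstructiveQFTBalabanRG`
(`BalabanUVStability4`) are SCHEMATIC CONCRETE predicates (ℤ^d, one lattice, stub recursion) for a B16-type end
statement; this file is the paper-by-paper implication structure of the printed series over abstract leaves and makes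
no claim about those predicates. `Setup` (same directory) is the typed vocabulary the leaves will be bound over.
HONEST FRAMING: value = the kernel-checked shape of the dependency chain, of the printed end statement and of the
located gaps — a typed skeleton and census, NOT progress on any open problem.
-/

namespace Literature.MathematicalPhysics.QuantumFieldTheory.Balaban1983to89.Dag

/-! ## The leaves -/

/-- The LEAVES of the citation DAG of the series: one abstract proposition per quoted main-theorem block of the papers
B4–B16 and per regime / coupling-flow statement mentioned by the end theorem. Parameters, never asserted; to be bound
to the per-paper named facts (module docstring). Pages are journal pages. [cite: Balaban1989LargeFieldII, Introduction pp.355–356] -/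
structure Leaves where
  /-- B4 (CMP 89:571, Balaban1983RegularityDecay): Theorem p. 573 (= Prop. 2.1 of (Higgs)₂,₃ I), Prop. 2.3 of I and
  Prop. 3.1′ of II as restated p. 574, Sect. 5 Theorem p. 594 — regularity and exponential decay of covariant lattice
  Green's functions by the generalized random walk expansion. -/
  b4 : Prop
  /-- B5 (CMP 95:17, Balaban1984PropagatorsI): Prop. 1.1 (1.89)–(1.90) p. 33, Prop. 1.2 (1.110)–(1.117) pp. 35–36 —
  bounds, regularity and `exp(−δ₀|y − y′|)` decay of the propagators of the averaged Gaussian vector-field action. -/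
  b5 : Prop
  /-- B6 (CMP 96:223, Balaban1984PropagatorsII): Lemma 2.1 and Prop. 2.2 p. 234, Prop. 2.3 p. 238, Lemma 2.4 (2.128)
  p. 245, Props. 2.5–2.7 pp. 246–249 — the same for operators restricted to sequences of domains and for
  (Q′G′²Q′*)⁻¹, (QGQ*)⁻¹, G_D. Cell census [G-B6-09]: the intermediate lower bound printed between (2.126) and (2.127),
  p. 245, fails for L ≥ 10 (kernel-checked witness, d = 2, L = 10) while the series uses L odd > 11; the printed
  constant 1/(12d²) of (2.128) is unsupported there (a d, L-dependent constant survives). The leaf is the stated block. -/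
  b6 : Prop
  /-- B7 (CMP 98:17, Balaban1985Averaging): Props. 1–10 pp. 26–50 (Prop. 2 (54) p. 26; Props. 6–7 analyticity p. 43;
  Prop. 8 averages of gauge transformations p. 45) — block averages of group-valued configurations are regular and
  analytic under the regularity condition (52). -/
  b7 : Prop
  /-- B8 (CMP 99:75, Balaban1985RegularSpaces): Lemma 1 p. 79, Thm 2 p. 83, Prop. 3 p. 87, Thm 4 p. 88, Prop. 5 p. 94,
  Prop. 6 p. 99, Prop. 7 p. 100, Thm 8 p. 101 — regular orbits meet the axial gauge-fixing surface in exactly one small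
  regular configuration. (The generalization (1.147) is printed as unproved [G-B8-09] and is not part of the leaf.) -/
  b8 : Prop
  /-- B9 (CMP 99:389, Balaban1985BackgroundPropagators): Thms 3.1–3.4 pp. 397–400, Cors. 3.5–3.6 pp. 407–408, Thm 3.7
  p. 409, Cor. 3.8 p. 410, Thms 3.9–3.11 pp. 413–416, Thms 3.12–3.14 pp. 423–426, Thm 3.15 p. 432 — regularity,
  analyticity and decay of background-field propagators; generalized random walk expansions (3.107)–(3.108) p. 415. -/
  b9 : Prop
  /-- B10 (CMP 102:255, Balaban1985UV3): Thm 1 p. 257 (d = 3 ultraviolet stability, bounds (5)) and Thm 2 p. 272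
  (inductive inequalities (41), (47)); the author: "the proof is very sketchy" (p. 257). Template of B12–B16. -/
  b10 : Prop
  /-- B11 (CMP 102:277, Balaban1985Variational): Thm 1 p. 279 (minimal orbit: existence in the space (8), uniqueness,
  regularity (9)–(10); "The constants a₀, a₁, B₃, depend on d and L only") and Props. 2–9 pp. 281–309 (Prop. 4
  (97)–(98) pp. 292–293; Prop. 9 p. 309, analytic extension and the Landau-gauge function 𝓗(B)). -/
  b11 : Prop
  /-- B12 (CMP 109:249, Balaban1987RG1) Sects. 2–5 pp. 264–301: expansion of the (k+1)-st small-field fluctuation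
  integral, analytic extensions, Ward–Takahashi identities, vacuum-polarization tensor and the β-function β_{k+1}
  of (1.20)–(1.22); Lemma 4 p. 280; p. 269: Thm 3 "reduced to proving the remaining properties". -/
  b12 : Prop
  /-- B13 (CMP 116:1, Balaban1988RG2Cluster): p. 1 "Thus we complete the proof of Theorem 3 of [I]" — the localized and
  exponentiated cluster expansion of the new effective-action term satisfies the inductive assumptions (I.1.7)–(I.1.19),
  in particular (I.1.18); Lemmas 1–3 pp. 9, 11, 20. -/
  b13 : Prop
  /-- Conclusion of B12 Thm 1 p. 259 / Thm 3 p. 264 (proof completed in B13): under the interval hypothesis the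
  small-field effective actions satisfy the inductive assumptions (1.1)–(1.22) for k ≤ K, in particular the
  representation (0.22)–(0.24) with (0.29) and the ε-uniform bound (0.30) p. 258. -/
  smallFieldInductive : Prop
  /-- B14 (CMP 119:243, Balaban1988Convergent) p. 244: the properties of the large-field renormalization operation R
  "incorporated in the inductive description" of Sect. 2 — ASSUMED in B14, constructed in B15–B16. -/
  rOperation : Prop
  /-- B15 (CMP 122:175, Balaban1989LargeFieldI): the basic step of R, definition (0.2)–(0.6) pp. 175–177 with the
  normalization (0.4), Prop. 1 p. 194, bounds (1.80), (1.89), and R′ (1.99)–(1.100) p. 201, as consumed by B16. -/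
  rBasicStep : Prop
  /-- Conclusion of B14 Thm 1 p. 262 = B16 Thm 1 p. 355: the densities ρ_k = (RT)^k ρ₀, k ≤ K, "have the form, and
  satisfy all the conditions and bounds, described in Sect. 2 [III]" (representation (2.18) p. 257, bounds of Thm 2
  (2.43)–(2.46), (2.49) p. 263). -/
  densitiesDescribed : Prop
  /-- B16 (0.1) pp. 355–356: `χ_k exp[−(1/g_k²)A(U_k) − E₋|T_η|] ≤ ρ_k ≤ exp E₊|T_η|` with "E₋, E₊ independent of k, T_η,
  U_k" (= B14 Cor. 3 (2.50) p. 264, where the constants are "independent of η and T, but depending on g_k"; the two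
  dependence clauses are recorded side by side by the cell, DIVERGENCE D3, and are not merged here). -/
  uvBounds : Prop
  /-- The INTERVAL HYPOTHESIS of B12 Thms 1/3, B14 Thm 1 (printed there as "(I.0.33)", a dangling reference [G2], read
  as this hypothesis) and B16 Thm 1: the effective couplings g_k, k = 0, …, K, generated by (0.20), lie in ]0, γ],
  γ sufficiently small (B12 p. 259, p. 264). -/
  smallCouplings : Prop
  /-- The hypotheses of B12 Thm 2 p. 259: d = 4, G = SU(2), γ and g sufficiently small, bare coupling g₀ = g₀(ε, g)
  suitably chosen, g_K = g. -/
  thm2Regime : Prop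
  /-- The two-sided logarithmic running (0.31) p. 259, conclusion of B12 Thm 2:
  `1/g² + β log(L^k ε)⁻¹ ≤ 1/g_k² ≤ 1/g² + β′ log(L^k ε)⁻¹` (cf. `Setup`'s `Flow.LogRunning`). -/
  running : Prop
  /-- Structural: the couplings are generated by the recursive renormalization group equations (0.20) p. 256,
  `1/g_k² = 1/g_{k+1}² + β_{k+1}(g_k)`, from g₀, with the β-functions of (1.20)–(1.22) (cf. `Setup`'s
  `Flow.SatisfiesRG`). True by construction in the papers; a leaf here because the flow steps consume it. -/
  rgFlow : Prop
  /-- PRINTED, proof deferred (B12 p. 264, on β_{j+1}): "It is a smooth function defined on the interval [0, γ], (or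
  analytic), uniformly bounded on this interval together with all derivatives." — continuity and a uniform upper bound
  β_j ≤ β′. Whether Sects. 2–5 of B12 prove this is a phase-2 reading item of the cell (T09b). -/
  betaSmoothBounded : Prop
  /-- UNPRINTED (located input T09.F of the cell; [G-f2.2], [G-r2.1]): uniform positivity of the β-functions,
  `∃ b > 0, ∀ j, ∀ x ∈ [0, γ], b ≤ β_j(x)` (uniformly in the volume) — discrete asymptotic freedom. B12 p. 264 defers
  "other properties" of β to "a separate paper"; B12 p. 259 stresses "we do not assume any special asymptotic behavior
  of the coupling constants"; no later paper of the series prints it. -/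
  betaPositive : Prop
  /-- FLOW CONTROL used by the inductive description of B14 §2: the inequalities (2.6) p. 255 — "g_n ≤ (1 + g_n²β′(n−m))^½ g_m
  ≤ … ≤ (1+β₀)(n−m)^½ g_m, g_m ≤ (1+β₀) g_n, where n > m, and β₀ > 0 can be chosen arbitrarily small, if g is
  sufficiently small" — their consequences (2.7)–(2.9), and the coupling-sum estimate `R₁ Σ_{j≤n} g_j^{κ₀} < g_n^{κ₀−6}`-type
  step inside (2.46) p. 263. -/
  flowControl : Prop

/-- The assignment making every leaf `True` (base point of the load-bearing witnesses below). [folklore] -/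
def allTrue : Leaves :=
  ⟨True, True, True, True, True, True, True, True, True, True, True, True, True, True, True, True, True, True, True,
    True, True, True⟩

/-! ## One `Prop` per paper: conclusions of the cited papers → own main theorems -/

/-- N01 · B4, the source node of the Yang–Mills chain (its inputs (Higgs)₂,₃ I–III are context: Theorem p. 573 is
"= Prop. 2.1 of [1]"). [cite: Balaban1983RegularityDecay, Theorem p.573 and Sect. 5 Theorem p.594] -/
def B4_main (ℓ : Leaves) : Prop := ℓ.b4

/-- N02 · B5 cites B4 as [2]: "We will apply the methods and results of paper [2]" (p. 17).
[cite: Balaban1984PropagatorsI, Props 1.1–1.2 pp.33–36] -/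
def B5_main (ℓ : Leaves) : Prop := ℓ.b4 → ℓ.b5

/-- N03 · B6 (part II of B5) cites B4 [3] and B5 [4] (p. 223; the Sect. 5 method of B4 for Props. 2.5–2.7).
[cite: Balaban1984PropagatorsII, Lemma 2.1–Prop 2.7 pp.234–249] -/
def B6_main (ℓ : Leaves) : Prop := ℓ.b4 → ℓ.b5 → ℓ.b6

/-- N04 · B7 cites B5 [2] (notation, averaging operations, propagators). [cite: Balaban1985Averaging, Props 1–10 pp.26–50] -/
def B7_main (ℓ : Leaves) : Prop := ℓ.b5 → ℓ.b7

/-- N06 · B9 cites B4 [2] (p. 398), B5 [3], B6 [4] (pp. 389, 397, 398, 410: Cor. 3.5 has B6 as its U = 1 base case)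
and B7 [5]. It does NOT use B8 (the edge B8 → B9 of the pair is one-way: B8 p. 86 imports Thm 3.3 of B9).
[cite: Balaban1985BackgroundPropagators, Thms 3.1–3.15 pp.397–432] -/
def B9_main (ℓ : Leaves) : Prop := ℓ.b4 → ℓ.b5 → ℓ.b6 → ℓ.b7 → ℓ.b9

/-- N05 · B8 cites B5 + B6 [2], B7 [3] (pp. 75, 95, 98) and B9 [4] ("Theorems 3.1, 3.2 of [4]" p. 92, Thm 3.3 of [4]
pp. 86–87). [cite: Balaban1985RegularSpaces, Thm 2 p.83, Thm 4 p.88, Thm 8 p.101] -/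
def B8_main (ℓ : Leaves) : Prop := ℓ.b5 → ℓ.b6 → ℓ.b7 → ℓ.b9 → ℓ.b8

/-- N07 · B11 cites (refs p. 309, uses located in the text) [2] = B5, [3] = B6 (Lemma 2.1 p. 289; (2.47)–(2.51)
p. 303), [4] = B7 (Props. 2, 4, 5), [5] = B9 (Thms 3.3, 3.12, 3.13), [6] = B8 (spaces of Sect. A, Thm 2 pp. 280, 301,
Prop. 7 p. 299, Lemma 1 p. 303). [cite: Balaban1985Variational, Thm 1 p.279 and Props 2–9 pp.281–309] -/
def B11_main (ℓ : Leaves) : Prop := ℓ.b5 → ℓ.b6 → ℓ.b7 → ℓ.b8 → ℓ.b9 → ℓ.b11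

/-- N08 · B10 cites [2]–[7] = B5, B6, B7, B9, B8, B11 (Thm 1 of [7] for the background fields); B1–B3 only as method.
[cite: Balaban1985UV3, Thm 1 p.257 and Thm 2 p.272] -/
def B10_main (ℓ : Leaves) : Prop := ℓ.b5 → ℓ.b6 → ℓ.b7 → ℓ.b8 → ℓ.b9 → ℓ.b11 → ℓ.b10

/-- N09 · B12 cites [8], [10], [11] = B4, B5, B6, [12] = B7, [14] = B8, [13] = B9, [16] = B10, [15] = B11; it DELIVERS
Sects. 2–5 (`b12`) and the reduction "Thm 3 ⇐ the remaining (cluster-expansion) properties" (p. 269), completed by B13;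
Thm 1/Thm 3 are stated under the interval hypothesis. [cite: Balaban1987RG1, Thm 1 p.259 and Thm 3 p.264] -/
def B12_main (ℓ : Leaves) : Prop :=
  ℓ.b4 → ℓ.b5 → ℓ.b6 → ℓ.b7 → ℓ.b8 → ℓ.b9 → ℓ.b10 → ℓ.b11 →
    (ℓ.b12 ∧ (ℓ.b12 → ℓ.b13 → (ℓ.smallCouplings → ℓ.smallFieldInductive)))

/-- N10 · B13 cites [I] = B12 (Sects. 3–5), [13] = B9, [15] = B11 (Prop. 4, pp. 5–6), [16] = B10.
[cite: Balaban1988RG2Cluster, p.1 and Lemma 3 p.20] -/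
def B13_main (ℓ : Leaves) : Prop := ℓ.b9 → ℓ.b10 → ℓ.b11 → ℓ.b12 → ℓ.b13

/-- N11 · B14 Thm 1 p. 262 (with the Theorem p. 245: the §2 description is reproduced by T): cites [I], [II] = B12, B13
(small-field analysis), [16] = B10 (template), [15] = B11, [14] = B8, [12] = B7, [13] = B9; R is only ASSUMED (p. 244);
the flow control (2.6)–(2.9) of §2 enters as an input (located step T11.F, see `FlowStepPrinted`).
[cite: Balaban1988Convergent, Thm 1 p.262, Thm 2 p.263, Cor 3 p.264] -/
def B14_main (ℓ : Leaves) : Prop :=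
  ℓ.b7 → ℓ.b8 → ℓ.b9 → ℓ.b10 → ℓ.b11 → (ℓ.smallCouplings → ℓ.smallFieldInductive) →
    (ℓ.smallCouplings → ℓ.flowControl) → (ℓ.rOperation → (ℓ.smallCouplings → ℓ.densitiesDescribed))

/-- N12 · B15, the basic step of R: cites [III] = B14 (description (2.18), (2.19)), [16] = B10, [14] = B8, [12] = B7.
RE-SOURCED in v4.2 (cell GAPS G-pv14-1, located, not load-bearing for the composition): the block `rBasicStep` contains
Prop. 1 p. 194, which [Balaban1989LargeFieldI] states WITHOUT proof (p. 194: "We will prove later the following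
theorem."); its only printed proof is [Balaban1989LargeFieldII] pp. 358–359 (p. 359: "Now we prove Proposition 1 [IV]."
… "Using Proposition 4 [15] and the fixed point theorem for contractive mappings, we can easily prove that the above
equation has exactly one solution" … "and Proposition 1 [IV] is proved. It is proved for ε_k instead of a general ε,
but the generalization is obvious."), resting on the quadratic form "defined by (1.65), (1.66) [10]. Using the bound
(1.67) [10] for this form" (p. 358), [10] = B5, and on "Proposition 4 [15]", [15] = B11; "the same simple argument as in
the proof of Lemma 2.4 in [11]" (p. 358), [11] = B6, enters as a METHOD, which this DAG's convention — see N13 on B8 —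
does not record as a leaf hypothesis. Hence the two further antecedents `b5`, `b11` (in-degree 3 → 5); the
composition `uv_stability_of_series` derives both before it uses this node, so the end statement and every
`dropWitness` are unchanged.
[cite: Balaban1989LargeFieldI, Prop 1 p.194] [cite: Balaban1989LargeFieldII, pp.358–359] -/
def B15_main (ℓ : Leaves) : Prop := ℓ.b5 → ℓ.b7 → ℓ.b8 → ℓ.b10 → ℓ.b11 → ℓ.rBasicStep

/-- N13 · B16 Thm 1 p. 355 and "Corollary 3" (= Cor. 3 of [III]) pp. 387, 391 ("This completes the proof of Theorem 1
and Corollary 3."): cites [IV] = B15, [III] = B14, [I], [II] = B12, B13, [15] = B11 (Thm 1), [13] = B9 (every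
B10–B16 use of B9's Sect. D results carries the interface caveat G-B9-11 of the cell), [16] = B10 ((71)), [10], [11] =
B5, B6, [12] = B7 ("the explicit formula (106) [12]", p. 373). DIRECT B13 EDGE (v4.1): "the Mayer expansion of the
exponential, the same as in (7.1) [I]" (p. 387) and "given by the convergent series (7.13) [I] … and it satisfies the
inequality (1.99)" (p. 390) cite equations that do not exist in the printed [I] = B12 (Sects. 0–5); under the
one-paper numbering of [I] resolved in the cell's DIVERGENCE.md D-T1 ("[I] Sect. 7" = B13 Sect. 2: Mayer expansion
(2.1), polymer expansion (2.12)–(2.13)) they are B13's cluster-expansion results. B8 enters only as a METHOD ("by the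
same reasoning as in the proof of Lemma 1 [14]", pp. 378, 382) and is therefore not a hypothesis of this node. The
node DISCHARGES the R-assumption of B14 and proves (2.50) [III], i.e. (0.1). [cite: Balaban1989LargeFieldII, Thm 1 and (0.1) p.355; pp.373, 387, 390, 391] -/
def B16_main (ℓ : Leaves) : Prop :=
  ℓ.b5 → ℓ.b6 → ℓ.b7 → ℓ.b9 → ℓ.b10 → ℓ.b11 → ℓ.b13 → ℓ.rBasicStep → (ℓ.smallCouplings → ℓ.smallFieldInductive) →
    (ℓ.rOperation ∧ ((ℓ.smallCouplings → ℓ.densitiesDescribed) → (ℓ.smallCouplings → ℓ.uvBounds)))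

/-! ## The end statement (B) and the located unprinted steps -/

/-- (B): what the series proves at its end — B16 Thm 1 together with (0.1) — in its PRINTED CONDITIONAL form
(hypothesis: the interval hypothesis on the couplings). [cite: Balaban1989LargeFieldII, Thm 1 and (0.1) p.355] -/
def UVStability4D (ℓ : Leaves) : Prop := ℓ.smallCouplings → (ℓ.densitiesDescribed ∧ ℓ.uvBounds)

/-- B12 Thm 2 p. 259 (d = 4, G = SU(2)) — PRINTED WITHOUT PROOF ("A proof of this theorem … will be given in a
separate paper"; B16 p. 355, 1989: "has not been published yet") [G1]: in the Thm-2 regime the couplings stay in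
]0, γ] and run as (0.31). A claim under adjudication, typed as a proposition, never asserted. [cite: Balaban1987RG1, Thm 2 p.259] -/
def B12_Thm2 (ℓ : Leaves) : Prop := ℓ.thm2Regime → (ℓ.smallCouplings ∧ ℓ.running)

/-- LOCATED STEP T11.F, as USED: B14 §2 p. 255 passes from the interval hypothesis (all that B14 Thm 1 / B16 Thm 1
assume) to the flow control (2.6)–(2.9) (and (2.46) p. 263 uses a coupling-sum bound of the same kind), printing only
"The inequalities follow from the renormalization group equations (0.20) [I], and from the properties of the
β-functions." Cell findings, kernel-checked on real sequences in the staged `Step`/`B14` modules [G-r2.1, G-f2.1]: from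
(0.20) with 0 ≤ β_j ≤ β′ and g small, (2.6) follows; the (2.46) sum bound follows from β_j ≥ b > 0; the interval
hypothesis ALONE does not imply it (witness g_j ≡ 1/2, n = 65). Hence an explicit hypothesis of `uv_stability_of_series`,
never a fact. [cite: Balaban1988Convergent, (2.6) p.255] -/
def FlowStepPrinted (ℓ : Leaves) : Prop := ℓ.smallCouplings → ℓ.flowControl

/-- The elementary reduction behind T11.F with its inputs displayed: RG equations (structural) + printed smoothness and
boundedness of β + UNPRINTED positivity of β + interval hypothesis ⇒ flow control. For (2.6) and the (2.46) sum
bound this is kernel-checked on real sequences in the staged modules (`Step` Part A `B14_2_6a–d`,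
`sum_sixth_powers_le`; `B14.flowIneq26_of_rg_two_sided`); the passage (2.6) ⇒ (2.7)–(2.9) is B14's ("They imply the
following inequalities", p. 255). A hypothesis here, to be discharged once the leaves are bound.
[cite: Balaban1988Convergent, (2.6)–(2.9) p.255 and (2.46) p.263] -/
def FlowStepOfBeta (ℓ : Leaves) : Prop :=
  ℓ.rgFlow → ℓ.betaSmoothBounded → ℓ.betaPositive → ℓ.smallCouplings → ℓ.flowControl

/-- LOCATED INPUT T09.F: the elementary content of B12 Thm 2 — continuity of the β_j and uniform bounds
0 < b ≤ β_j ≤ β′ give, by the intermediate value theorem, a g₀ with g_K = g, all g_k ∈ ]0, γ] and (0.31)-type running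
(kernel-checked on real sequences in the staged `Step`: `couplingTrajectory_exists`, `flow_exists_of_betaBounds`) — so
Thm 2 reduces to the one unprinted inequality `betaPositive` [G-f2.2]. A hypothesis here. [cite: Balaban1987RG1, Thm 2 p.259 and p.264] -/
def Thm2OfBeta (ℓ : Leaves) : Prop := ℓ.rgFlow → ℓ.betaSmoothBounded → ℓ.betaPositive → B12_Thm2 ℓ

/-! ## Bookkeeping theorems -/

/-- BOOKKEEPING (deliverable of the cell): the thirteen paper nodes, each read "cited conclusions → own conclusion",
together with the located step `FlowStepPrinted` (B14 p. 255), compose to the end statement (B) in its printed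
conditional form. [cite: Balaban1989LargeFieldII, Thm 1 and (0.1) p.355] -/
theorem uv_stability_of_series (ℓ : Leaves) :
    B4_main ℓ → B5_main ℓ → B6_main ℓ → B7_main ℓ → B8_main ℓ → B9_main ℓ → B10_main ℓ → B11_main ℓ →
    B12_main ℓ → B13_main ℓ → B14_main ℓ → B15_main ℓ → B16_main ℓ → FlowStepPrinted ℓ → UVStability4D ℓ := by
  intro h4 h5 h6 h7 h8 h9 h10 h11 h12 h13 h14 h15 h16 hflow
  have c4 : ℓ.b4 := h4
  have c5 : ℓ.b5 := h5 c4
  have c6 : ℓ.b6 := h6 c4 c5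
  have c7 : ℓ.b7 := h7 c5
  have c9 : ℓ.b9 := h9 c4 c5 c6 c7
  have c8 : ℓ.b8 := h8 c5 c6 c7 c9
  have c11 : ℓ.b11 := h11 c5 c6 c7 c8 c9
  have c10 : ℓ.b10 := h10 c5 c6 c7 c8 c9 c11
  have e12 := h12 c4 c5 c6 c7 c8 c9 c10 c11
  have c13 : ℓ.b13 := h13 c9 c10 c11 e12.1
  have sf : ℓ.smallCouplings → ℓ.smallFieldInductive := e12.2 e12.1 c13
  have rb : ℓ.rBasicStep := h15 c5 c7 c8 c10 c11
  have e16 := h16 c5 c6 c7 c9 c10 c11 c13 rb sf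
  have dd : ℓ.smallCouplings → ℓ.densitiesDescribed := h14 c7 c8 c9 c10 c11 sf hflow e16.1
  intro hg
  exact ⟨dd hg, e16.2 dd hg⟩

/-- Where the unpublished B12 Thm 2 would enter: with it, (B) is unconditional in the Thm-2 regime
(d = 4, G = SU(2), g small, g₀ = g₀(ε, g)) — B16 p. 355: "Theorem 2 of [I] allows us to remove the assumption on the
effective coupling constants in the above theorem". [cite: Balaban1989LargeFieldII, Introduction p.355] -/
theorem uv_stability_via_Thm2 (ℓ : Leaves) :
    B12_Thm2 ℓ → UVStability4D ℓ → (ℓ.thm2Regime → ℓ.densitiesDescribed ∧ ℓ.uvBounds) :=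
  fun h2 hB hr => hB (h2 hr).1

/-- `FlowStepPrinted` from the displayed elementary reduction and its three inputs. [cite: Balaban1988Convergent, (2.6) p.255] -/
theorem flowStepPrinted_of_beta (ℓ : Leaves) :
    FlowStepOfBeta ℓ → ℓ.rgFlow → ℓ.betaSmoothBounded → ℓ.betaPositive → FlowStepPrinted ℓ :=
  fun h hrg hsb hpos => h hrg hsb hpos

/-- THE CENSUS IN ONE STATEMENT: the thirteen paper nodes + the two elementary reductions (`FlowStepOfBeta`,
`Thm2OfBeta`, kernel-checked on real sequences in the staged modules) + the structural `rgFlow` + the PRINTED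
(proof-deferred) `betaSmoothBounded` + the UNPRINTED `betaPositive` give the end statement UNCONDITIONALLY in the Thm-2
regime. Every hypothesis is a named leaf or node; nothing is asserted. [cite: Balaban1989LargeFieldII, Thm 1 and (0.1) p.355] -/
theorem uv_stability_modulo_beta (ℓ : Leaves) :
    B4_main ℓ → B5_main ℓ → B6_main ℓ → B7_main ℓ → B8_main ℓ → B9_main ℓ → B10_main ℓ → B11_main ℓ →
    B12_main ℓ → B13_main ℓ → B14_main ℓ → B15_main ℓ → B16_main ℓ → FlowStepOfBeta ℓ → Thm2OfBeta ℓ →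
    ℓ.rgFlow → ℓ.betaSmoothBounded → ℓ.betaPositive → (ℓ.thm2Regime → ℓ.densitiesDescribed ∧ ℓ.uvBounds) := by
  intro h4 h5 h6 h7 h8 h9 h10 h11 h12 h13 h14 h15 h16 hfs h2 hrg hsb hpos
  exact uv_stability_via_Thm2 ℓ (h2 hrg hsb hpos)
    (uv_stability_of_series ℓ h4 h5 h6 h7 h8 h9 h10 h11 h12 h13 h14 h15 h16
      (flowStepPrinted_of_beta ℓ hfs hrg hsb hpos))

/-! ## No hypothesis is decorative -/

/-- The fourteen hypotheses of `uv_stability_of_series` as a list, in the order B4, B5, B6, B7, B8, B9, B10, B11, B12,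
B13, B14, B15, B16, `FlowStepPrinted`. [folklore] -/
def hyps (ℓ : Leaves) : List Prop :=
  [B4_main ℓ, B5_main ℓ, B6_main ℓ, B7_main ℓ, B8_main ℓ, B9_main ℓ, B10_main ℓ, B11_main ℓ, B12_main ℓ, B13_main ℓ,
    B14_main ℓ, B15_main ℓ, B16_main ℓ, FlowStepPrinted ℓ]

/-- `uv_stability_of_series` restated over the list of hypotheses. [folklore] -/
theorem uv_stability_of_hyps (ℓ : Leaves) (h : ∀ p ∈ hyps ℓ, p) : UVStability4D ℓ := by
  have h4 : B4_main ℓ := h _ (by simp [hyps])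
  have h5 : B5_main ℓ := h _ (by simp [hyps])
  have h6 : B6_main ℓ := h _ (by simp [hyps])
  have h7 : B7_main ℓ := h _ (by simp [hyps])
  have h8 : B8_main ℓ := h _ (by simp [hyps])
  have h9 : B9_main ℓ := h _ (by simp [hyps])
  have h10 : B10_main ℓ := h _ (by simp [hyps])
  have h11 : B11_main ℓ := h _ (by simp [hyps])
  have h12 : B12_main ℓ := h _ (by simp [hyps])
  have h13 : B13_main ℓ := h _ (by simp [hyps])
  have h14 : B14_main ℓ := h _ (by simp [hyps])
  have h15 : B15_main ℓ := h _ (by simp [hyps])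
  have h16 : B16_main ℓ := h _ (by simp [hyps])
  have hfl : FlowStepPrinted ℓ := h _ (by simp [hyps])
  exact uv_stability_of_series ℓ h4 h5 h6 h7 h8 h9 h10 h11 h12 h13 h14 h15 h16 hfl

/-- For each hypothesis (position `i` in `hyps`; any `i ≥ 13` means `FlowStepPrinted`), a truth-value assignment to the leaves under which every OTHER
hypothesis holds and (B) fails: the conclusion block of the dropped paper and everything downstream of it is `False`,
the rest `True` (for `FlowStepPrinted`: flow control and the densities' description fail). [folklore] -/
def dropWitness : ℕ → Leaves
  | 0 =>
    { allTrue with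
      b4 := False, b5 := False, b6 := False, b7 := False, b8 := False, b9 := False, b10 := False, b11 := False,
      b12 := False, b13 := False, smallFieldInductive := False, rOperation := False, rBasicStep := False,
      densitiesDescribed := False, uvBounds := False }
  | 1 =>
    { allTrue with
      b5 := False, b6 := False, b7 := False, b8 := False, b9 := False, b10 := False, b11 := False, b12 := False,
      b13 := False, smallFieldInductive := False, rOperation := False, rBasicStep := False,
      densitiesDescribed := False, uvBounds := False }
  | 2 =>
    { allTrue with
      b6 := False, b8 := False, b9 := False, b10 := False, b11 := False, b12 := False, b13 := False,
      smallFieldInductive := False, rOperation := False, rBasicStep := False, densitiesDescribed := False,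
      uvBounds := False }
  | 3 =>
    { allTrue with
      b7 := False, b8 := False, b9 := False, b10 := False, b11 := False, b12 := False, b13 := False,
      smallFieldInductive := False, rOperation := False, rBasicStep := False, densitiesDescribed := False,
      uvBounds := False }
  | 4 =>
    { allTrue with
      b8 := False, b10 := False, b11 := False, b12 := False, b13 := False, smallFieldInductive := False,
      rOperation := False, rBasicStep := False, densitiesDescribed := False, uvBounds := False }
  | 5 =>
    { allTrue with
      b9 := False, b8 := False, b10 := False, b11 := False, b12 := False, b13 := False,
      smallFieldInductive := False, rOperation := False, rBasicStep := False, densitiesDescribed := False,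
      uvBounds := False }
  | 6 =>
    { allTrue with
      b10 := False, b12 := False, b13 := False, smallFieldInductive := False, rOperation := False,
      rBasicStep := False, densitiesDescribed := False, uvBounds := False }
  | 7 =>
    { allTrue with
      b11 := False, b10 := False, b12 := False, b13 := False, smallFieldInductive := False, rOperation := False,
      rBasicStep := False, densitiesDescribed := False, uvBounds := False }
  | 8 =>
    { allTrue with b12 := False, b13 := False, smallFieldInductive := False, densitiesDescribed := False, uvBounds := False }
  | 9 => { allTrue with b13 := False, smallFieldInductive := False, densitiesDescribed := False, uvBounds := False }
  | 10 => { allTrue with densitiesDescribed := False }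
  | 11 => { allTrue with rBasicStep := False, rOperation := False, densitiesDescribed := False, uvBounds := False }
  | 12 => { allTrue with uvBounds := False }
  | _ => { allTrue with flowControl := False, densitiesDescribed := False }

/-- NO HYPOTHESIS OF `uv_stability_of_series` IS DECORATIVE: dropping any one of the fourteen (position `i` of
`hyps`), the remaining thirteen hold at `dropWitness i` while (B) fails there. (So the parametric leaves make the
bookkeeping theorem contentful as a statement about SHAPES; the content of the leaves themselves is the per-paper
modules' business.) [folklore] -/
theorem hyp_loadBearing :
    ∀ i < 14, (∀ p ∈ (hyps (dropWitness i)).eraseIdx i, p) ∧ ¬ UVStability4D (dropWitness i) := by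
  intro i hi
  interval_cases i <;>
    simp [hyps, dropWitness, allTrue, B4_main, B5_main, B6_main, B7_main, B8_main, B9_main, B10_main, B11_main,
      B12_main, B13_main, B14_main, B15_main, B16_main, FlowStepPrinted, UVStability4D]

end Literature.MathematicalPhysics.QuantumFieldTheory.Balaban1983to89.Dag
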